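import Mathlib.LinearAlgebra.Matrix.NonsingularInverse
import Mathlib.LinearAlgebra.Matrix.Rank
import Mathlib.Order.ConditionallyCompleteLattice.Finset
import Literature.Barriers.Schanuel.AlgebraicIndependenceOfLogarithms
import Literature.Barriers.Schanuel.AlgebraicIndependenceOfLogarithmsRankProofs
import HarnessLib

/-!
# Barrier (Schanuel): the strong six exponentials theorem from Roy's rank bound (Roy 1992, §4)

Companion to `Literature.Barriers.Schanuel.AlgebraicIndependenceOfLogarithms`, whose named fact
`Literature.Barriers.Schanuel.roy1992_strongSixExponentials` renders **Corollary 2 of §4** of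
[Roy1992] (the strong six exponentials theorem: a `2 × 3` matrix with entries in
`𝓛̃ = ℚ̄ + ℚ̄·L` whose rows and whose columns are `ℚ̄`-linearly independent has rank `2`).

## Status of the fact (triage: XL) and what this file does

In print the result is the last link of the chain
Theorem 1 (M. Waldschmidt: Theorem 4.1 of [Waldschmidt1988] for the linear group
`G_a^{d₀} × G_m^{d₁}`, the algebraic subgroup theorem in several variables, proved there from an
auxiliary function and Philippon's zero estimate) ⟹ Theorem 2 (§§2–3) ⟹ Theorem 4 (§4, p. 34)
⟹ Corollary 1 (p. 38: the lower bound `rank M ≥ θ̃(M)·d/(1 + θ̃(M))` for `d × l` matrices with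
entries in `𝓛̃`) ⟹ Corollary 2 [Roy1992, pp. 25, 34, 37–38]. The transcendence input (Theorem 1)
is a whole theory which the tree does not have, so `roy1992_strongSixExponentials` is not
discharged here. This file formalises the top of the chain exactly as printed:

* `thetaBar` — Roy's invariant `θ̃(M)`: "the minimum of all ratios `l'/d'`, when `(d', l')` runs
  among the couples of integers satisfying `0 < d' ≤ d` and `0 ≤ l' ≤ l`, for which there exist
  matrices `P ∈ GL_d(ℚ̄)` and `Q ∈ GL_l(ℚ̄)` such that the product `PMQ` can be written
  `(M' 0; N N')` with `M'` of size `d' × l'`" [Roy1992, §4 p. 37] (`IsBlockCouple` is the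
  admissibility of a couple; `θ̃` is real-valued, an infimum of a finite non-empty set, attained:
  `exists_isBlockCouple_thetaBar_eq`).
* `roy1992_cor1` — **Corollary 1** as a named fact: "Let `M` be a matrix with coefficients in `𝓛̃`,
  of size `d × l` with `d, l > 0`, and let `n` be its rank. We have `n ≥ θ̃(M)·d/(1 + θ̃(M))`"
  [Roy1992, §4 Corollary 1 (p. 38)].
* `roy1992_strongSixExponentials_of_cor1` — **Corollary 2 PROVED from Corollary 1**, following the
  printed proof: "for each matrix `M` of size `d × l` with `d, l > 0`, of rank `1`, whose rows and
  columns are linearly independent over `ℚ̄`, we have `θ̃(M) = l/d`. In our situation, if the rank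
  of `M` were `1`, we would thus have `θ̃(M) = 3/2`, and this would contradict Corollary 1"
  [Roy1992, §4 proof of Corollary 2 (p. 38)] (`le_thetaBar_of_rank_le_one` proves
  `θ̃(M) ≥ l/d` for such matrices of any size: in `PMQ`, of rank `≤ 1`, a zero entry forces a zero
  row or a zero column, i.e. a `ℚ̄`-linear relation among the rows or the columns of `M`).

What is NOT here: Theorem 4 and the deduction of Corollary 1 from it (the base-change argument of
p. 38), Theorems 1–2; they are the subject of further companions. `𝓛̃` is the companion's
`logLinearForms` (the `ℚ̄`-span of `{1} ∪ L`, `ℚ̄ = algebraicClosure ℚ ℂ`), for `K = ℂ`.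

## References

* [Roy1992] D. Roy, *Matrices whose coefficients are linear forms in logarithms*, J. Number
  Theory 41 (1992) 22–47: Notations p. 24 (`𝓛̃ = ℚ̄ + ℚ̄·L`, rationality over `ℚ̄`); §1
  Theorems 1–2 (p. 25); §4 Theorem 4 (p. 34), definition of `θ̃` (p. 37), Corollary 1 and
  Corollary 2 with their proofs (p. 38).
* [Waldschmidt1988] M. Waldschmidt, *On the transcendence methods of Gel'fond and Schneider in
  several variables*, in: New Advances in Transcendence Theory (A. Baker ed.), Cambridge Univ.
  Press 1988, 375–398: Theorem 4.1; §2 Corollary 2.1 (the case `ℚ̄ + L`).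
* [Waldschmidt2005] M. Waldschmidt, *Variations on the six exponentials theorem* (2005), §2
  Theorem 2.1 (the statement, attributed to Roy).
-/

noncomputable section

open Complex

namespace Literature.Barriers.Schanuel

variable {d l : ℕ}

/-! ### Roy's invariant `θ̃(M)` -/

/-- **Admissible couples for `θ̃(M)`.** For a complex `d × l` matrix `M`, the couple `(d', l')` is
admissible if `0 < d' ≤ d`, `0 ≤ l' ≤ l` and there are `P ∈ GL_d(ℚ̄)`, `Q ∈ GL_l(ℚ̄)` such that
`PMQ = (M' 0; N N')` with `M'` of size `d' × l'`, i.e. the entries of `PMQ` in the first `d'` rows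
and the last `l − l'` columns vanish (`ℚ̄ = algebraicClosure ℚ ℂ`, acting through the inclusion).
[cite: Roy1992, §4 (definition of θ̃, p. 37)] -/
def IsBlockCouple (M : Matrix (Fin d) (Fin l) ℂ) (d' l' : ℕ) : Prop :=
  0 < d' ∧ d' ≤ d ∧ l' ≤ l ∧
    ∃ (P : Matrix (Fin d) (Fin d) (algebraicClosure ℚ ℂ))
      (Q : Matrix (Fin l) (Fin l) (algebraicClosure ℚ ℂ)), IsUnit P ∧ IsUnit Q ∧
      ∀ (i : Fin d) (j : Fin l), (i : ℕ) < d' → l' ≤ (j : ℕ) →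
        (P.map (algebraMap (algebraicClosure ℚ ℂ) ℂ) * M *
          Q.map (algebraMap (algebraicClosure ℚ ℂ) ℂ)) i j = 0

/-- The set of admissible couples `(d', l')` of `M`. [cite: Roy1992, §4 (definition of θ̃, p. 37)] -/
def blockCouples (M : Matrix (Fin d) (Fin l) ℂ) : Set (ℕ × ℕ) :=
  {c | IsBlockCouple M c.1 c.2}

/-- **Roy's `θ̃(M)`**: "the minimum of all ratios `l'/d'`, when `(d', l')` runs among the couples
of integers satisfying `0 < d' ≤ d` and `0 ≤ l' ≤ l`, for which there exist matrices
`P ∈ GL_d(ℚ̄)` and `Q ∈ GL_l(ℚ̄)` such that the product `PMQ` can be written `(M' 0; N N')` with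
`M'` of size `d' × l'`. This number thus depends only on the eventual relations of linear
dependence over `ℚ̄` between the coefficients of `M`." Real-valued; the infimum is over a finite
set, non-empty when `d > 0` (the couple `(d, l)`), hence a minimum
(`exists_isBlockCouple_thetaBar_eq`); for `d = 0` the set is empty and the value is the junk
`sInf ∅`. [cite: Roy1992, §4 (definition of θ̃, p. 37)] -/
def thetaBar (M : Matrix (Fin d) (Fin l) ℂ) : ℝ :=
  sInf ((fun c : ℕ × ℕ => (c.2 : ℝ) / (c.1 : ℝ)) '' blockCouples M)

/-- `(d, l)` is admissible when `d > 0` (`P = Q = 1`, empty zero block). [cite: Roy1992, §4 (definition of θ̃, p. 37)] -/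
theorem isBlockCouple_self (M : Matrix (Fin d) (Fin l) ℂ) (hd : 0 < d) : IsBlockCouple M d l := by
  refine ⟨hd, le_rfl, le_rfl, 1, 1, isUnit_one, isUnit_one, ?_⟩
  intro i j _ hj
  exact absurd hj (not_le.2 j.isLt)

/-- The admissible couples form a finite set (contained in `[0, d] × [0, l]`). [folklore] -/
theorem blockCouples_finite (M : Matrix (Fin d) (Fin l) ℂ) : (blockCouples M).Finite := by
  refine Set.Finite.subset (Finset.finite_toSet (Finset.range (d + 1) ×ˢ Finset.range (l + 1))) ?_
  rintro ⟨d', l'⟩ ⟨_, hd', hl', -⟩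
  simp only [Finset.coe_product, Finset.coe_range, Set.mem_prod, Set.mem_Iio]
  omega

/-- `θ̃(M) ≤ l'/d'` for every admissible couple `(d', l')`. [cite: Roy1992, §4 (definition of θ̃, p. 37)] -/
theorem thetaBar_le_div {M : Matrix (Fin d) (Fin l) ℂ} {d' l' : ℕ} (h : IsBlockCouple M d' l') :
    thetaBar M ≤ (l' : ℝ) / (d' : ℝ) :=
  csInf_le ((blockCouples_finite M).image _).bddBelow ⟨(d', l'), h, rfl⟩

/-- `θ̃(M) ≤ l/d` (`d > 0`). [cite: Roy1992, §4 (definition of θ̃, p. 37)] -/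
theorem thetaBar_le (M : Matrix (Fin d) (Fin l) ℂ) (hd : 0 < d) :
    thetaBar M ≤ (l : ℝ) / (d : ℝ) :=
  thetaBar_le_div (isBlockCouple_self M hd)

/-- The minimum defining `θ̃(M)` is attained (`d > 0`). [cite: Roy1992, §4 (definition of θ̃, p. 37)] -/
theorem exists_isBlockCouple_thetaBar_eq (M : Matrix (Fin d) (Fin l) ℂ) (hd : 0 < d) :
    ∃ d' l' : ℕ, IsBlockCouple M d' l' ∧ thetaBar M = (l' : ℝ) / (d' : ℝ) := by
  have hne : ((fun c : ℕ × ℕ => (c.2 : ℝ) / (c.1 : ℝ)) '' blockCouples M).Nonempty :=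
    ⟨_, (d, l), isBlockCouple_self M hd, rfl⟩
  obtain ⟨⟨d', l'⟩, hc, heq⟩ := hne.csInf_mem ((blockCouples_finite M).image _)
  exact ⟨d', l', hc, heq.symm⟩

/-- A lower bound valid for all admissible ratios bounds `θ̃(M)` from below (`d > 0`).
[cite: Roy1992, §4 (definition of θ̃, p. 37)] -/
theorem le_thetaBar {M : Matrix (Fin d) (Fin l) ℂ} (hd : 0 < d) {x : ℝ}
    (h : ∀ d' l' : ℕ, IsBlockCouple M d' l' → x ≤ (l' : ℝ) / (d' : ℝ)) : x ≤ thetaBar M := by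
  obtain ⟨d', l', hc, heq⟩ := exists_isBlockCouple_thetaBar_eq M hd
  rw [heq]
  exact h d' l' hc

/-- `0 ≤ θ̃(M)` (`d > 0`). [folklore] -/
theorem thetaBar_nonneg (M : Matrix (Fin d) (Fin l) ℂ) (hd : 0 < d) : 0 ≤ thetaBar M :=
  le_thetaBar hd fun _ _ _ => by positivity

/-! ### Corollary 1 (named fact) -/

/-- **Roy 1992, §4 Corollary 1 (lower bound for the rank of matrices of linear forms in
logarithms).** "Let `M` be a matrix with coefficients in `𝓛̃`, of size `d × l` with `d, l > 0`,
and let `n` be its rank. We have `n ≥ θ̃(M)·d / (1 + θ̃(M))`." Here `𝓛̃ = ℚ̄ + ℚ̄·L` is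
`logLinearForms` (`K = ℂ`) and `θ̃` is `thetaBar`. Deduced in print from Theorem 4 (itself from
Waldschmidt's Theorem 1 via Theorem 2); named fact, users take `(h : roy1992_cor1)`.
[cite: Roy1992, §4 Corollary 1 (p. 38)] -/
def roy1992_cor1 : Prop :=
  ∀ (d l : ℕ) (M : Matrix (Fin d) (Fin l) ℂ), 0 < d → 0 < l → (∀ i j, M i j ∈ logLinearForms) →
    thetaBar M * d / (1 + thetaBar M) ≤ (M.rank : ℝ)

/-! ### Rank-one matrices with `ℚ̄`-independent rows and columns: `θ̃(M) = l/d` -/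

/-- In a matrix of rank `≤ 1`, a zero entry lies on a zero row or on a zero column (otherwise a
`2 × 2` minor through it is non-zero). [folklore] -/
theorem row_or_col_eq_zero_of_rank_le_one {m n : ℕ} (N : Matrix (Fin m) (Fin n) ℂ)
    (hN : N.rank ≤ 1) (i₀ : Fin m) (j₀ : Fin n) (h0 : N i₀ j₀ = 0) :
    (∀ j, N i₀ j = 0) ∨ (∀ i, N i j₀ = 0) := by
  by_contra hcon
  push Not at hcon
  obtain ⟨⟨j, hj⟩, ⟨i, hi⟩⟩ := hcon
  have hdet := det_submatrix_eq_zero_of_rank_le N hN ![i₀, i] ![j, j₀]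
  rw [Matrix.det_fin_two] at hdet
  simp only [Matrix.submatrix_apply, Matrix.cons_val_zero, Matrix.cons_val_one,
    Matrix.cons_val_fin_one, h0, zero_mul, sub_zero] at hdet
  rcases mul_eq_zero.1 hdet with h | h
  · exact hj h
  · exact hi h

/-- An invertible matrix over `ℚ̄` stays invertible in `ℂ`. [folklore] -/
theorem isUnit_map_algebraMap {n : ℕ} {P : Matrix (Fin n) (Fin n) (algebraicClosure ℚ ℂ)}
    (hP : IsUnit P) : IsUnit (P.map (algebraMap (algebraicClosure ℚ ℂ) ℂ)) :=
  hP.map (algebraMap (algebraicClosure ℚ ℂ) ℂ).mapMatrix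

/-- **The printed observation behind Corollary 2**: "for each matrix `M` of size `d × l` with
`d, l > 0`, of rank `1`, whose rows and columns are linearly independent over `ℚ̄`, we have
`θ̃(M) = l/d`" — proved as `l/d ≤ θ̃(M)` for rank `≤ 1` (the other inequality is `thetaBar_le`).
Proof: if `(d', l')` is admissible with `l' < l`, the entry `(0, l')` of `N = PMQ` lies in the zero
block; `N` has rank `≤ 1`, so its row `0` or its column `l'` vanishes; then row `0` of `PM`, resp.
column `l'` of `MQ`, vanishes, a non-trivial `ℚ̄`-linear relation among the rows, resp. columns,
of `M` (row `0` of `P`, resp. column `l'` of `Q`, is non-zero since `P`, `Q` are invertible).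
Hence `l' = l` and `l'/d' ≥ l/d`. [cite: Roy1992, §4 proof of Corollary 2 (p. 38)] -/
theorem le_thetaBar_of_rank_le_one (M : Matrix (Fin d) (Fin l) ℂ) (hd : 0 < d)
    (hrank : M.rank ≤ 1)
    (hrows : LinearIndependent (algebraicClosure ℚ ℂ) (fun i => M i))
    (hcols : LinearIndependent (algebraicClosure ℚ ℂ) (fun j => M.transpose j)) :
    (l : ℝ) / (d : ℝ) ≤ thetaBar M := by
  refine le_thetaBar hd fun d' l' hc => ?_
  obtain ⟨hd'0, hd'd, hl'l, P, Q, hP, hQ, hblock⟩ := hc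
  -- it suffices that `l' = l`
  suffices hl : l' = l by
    subst hl
    have hd0 : (0 : ℝ) < d := by exact_mod_cast hd
    have hd'0' : (0 : ℝ) < d' := by exact_mod_cast hd'0
    have hdd : (d' : ℝ) ≤ d := by exact_mod_cast hd'd
    rw [div_le_div_iff₀ hd0 hd'0']
    have hl0 : (0 : ℝ) ≤ l' := by positivity
    nlinarith
  by_contra hne
  have hlt : l' < l := lt_of_le_of_ne hl'l hne
  set P' : Matrix (Fin d) (Fin d) ℂ := P.map (algebraMap (algebraicClosure ℚ ℂ) ℂ) with hP'
  set Q' : Matrix (Fin l) (Fin l) ℂ := Q.map (algebraMap (algebraicClosure ℚ ℂ) ℂ) with hQ'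
  have hP'u : IsUnit P'.det := (Matrix.isUnit_iff_isUnit_det _).1 (isUnit_map_algebraMap hP)
  have hQ'u : IsUnit Q'.det := (Matrix.isUnit_iff_isUnit_det _).1 (isUnit_map_algebraMap hQ)
  set N : Matrix (Fin d) (Fin l) ℂ := P' * M * Q' with hN
  have hNrank : N.rank ≤ 1 := by
    rw [hN, Matrix.rank_mul_eq_left_of_isUnit_det _ _ hQ'u,
      Matrix.rank_mul_eq_right_of_isUnit_det _ _ hP'u]
    exact hrank
  have hzero : N ⟨0, hd⟩ ⟨l', hlt⟩ = 0 := hblock ⟨0, hd⟩ ⟨l', hlt⟩ hd'0 le_rfl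
  rcases row_or_col_eq_zero_of_rank_le_one N hNrank _ _ hzero with hrow | hcol
  · -- row `0` of `P M = N Q'⁻¹` vanishes: a relation among the rows of `M`
    have hPM : ∀ j, (P' * M) ⟨0, hd⟩ j = 0 := by
      intro j
      rw [← Matrix.mul_nonsing_inv_cancel_right Q' (P' * M) hQ'u, Matrix.mul_apply]
      exact Finset.sum_eq_zero fun k _ => by rw [← hN, hrow k, zero_mul]
    have hrel : ∑ k, P ⟨0, hd⟩ k • M k = 0 := by
      funext j
      rw [Finset.sum_apply]
      have := hPM j
      rw [Matrix.mul_apply] at this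
      simpa [hP', Matrix.map_apply, Pi.smul_apply, IntermediateField.smul_def, smul_eq_mul]
        using this
    have hProw : ∀ k, P ⟨0, hd⟩ k = 0 := Fintype.linearIndependent_iff.1 hrows _ hrel
    have hdet : P.det = 0 := Matrix.det_eq_zero_of_row_eq_zero ⟨0, hd⟩ hProw
    exact ((Matrix.isUnit_iff_isUnit_det P).1 hP).ne_zero hdet
  · -- column `l'` of `M Q = P'⁻¹ N` vanishes: a relation among the columns of `M`
    have hMQ : ∀ i, (M * Q') i ⟨l', hlt⟩ = 0 := by
      intro i
      rw [← Matrix.nonsing_inv_mul_cancel_left P' (M * Q') hP'u, ← Matrix.mul_assoc P' M Q',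
        ← hN, Matrix.mul_apply]
      exact Finset.sum_eq_zero fun k _ => by rw [hcol k, mul_zero]
    have hrel : ∑ k, Q k ⟨l', hlt⟩ • M.transpose k = 0 := by
      funext i
      rw [Finset.sum_apply]
      have := hMQ i
      rw [Matrix.mul_apply] at this
      simpa [hQ', Matrix.map_apply, Pi.smul_apply, Matrix.transpose_apply,
        IntermediateField.smul_def, smul_eq_mul, mul_comm] using this
    have hQcol : ∀ k, Q k ⟨l', hlt⟩ = 0 := Fintype.linearIndependent_iff.1 hcols _ hrel
    have hdet : Q.det = 0 := Matrix.det_eq_zero_of_column_eq_zero ⟨l', hlt⟩ hQcol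
    exact ((Matrix.isUnit_iff_isUnit_det Q).1 hQ).ne_zero hdet

/-- `θ̃(M) = l/d` for a rank-`≤ 1` matrix with `ℚ̄`-linearly independent rows and columns
(`d > 0`). [cite: Roy1992, §4 proof of Corollary 2 (p. 38)] -/
theorem thetaBar_eq_of_rank_le_one (M : Matrix (Fin d) (Fin l) ℂ) (hd : 0 < d)
    (hrank : M.rank ≤ 1)
    (hrows : LinearIndependent (algebraicClosure ℚ ℂ) (fun i => M i))
    (hcols : LinearIndependent (algebraicClosure ℚ ℂ) (fun j => M.transpose j)) :
    thetaBar M = (l : ℝ) / (d : ℝ) :=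
  le_antisymm (thetaBar_le M hd) (le_thetaBar_of_rank_le_one M hd hrank hrows hcols)

/-! ### Corollary 2 from Corollary 1 -/

/-- **The strong six exponentials theorem from Roy's Corollary 1** (PROVED reduction:
`roy1992_cor1 → roy1992_strongSixExponentials`), following the printed proof of Corollary 2: a
`2 × 3` matrix `M` with entries in `𝓛̃` and `ℚ̄`-independent rows and columns has rank `≤ 2`; if
its rank were `≤ 1` then `θ̃(M) = 3/2` (`thetaBar_eq_of_rank_le_one`; rank `0` is excluded by
the same lemma or directly), and Corollary 1 would give `rank M ≥ (3/2)·2/(1 + 3/2) = 6/5 > 1`.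
[cite: Roy1992, §4 Corollary 2 and its proof (p. 38)] -/
theorem roy1992_strongSixExponentials_of_cor1 (h : roy1992_cor1) :
    roy1992_strongSixExponentials := by
  intro M hM hrows hcols
  have hle : M.rank ≤ 2 := M.rank_le_height
  by_contra hne
  have hrank : M.rank ≤ 1 := by omega
  have hθ : thetaBar M = (3 : ℝ) / 2 := by
    have := thetaBar_eq_of_rank_le_one M two_pos hrank hrows hcols
    simpa using this
  have hcor := h 2 3 M two_pos three_pos hM
  rw [hθ] at hcor
  have hr : (M.rank : ℝ) ≤ 1 := by exact_mod_cast hrank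
  norm_num at hcor
  linarith

end Literature.Barriers.Schanuel
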